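import Literature.NumberTheory.EllipticCurves.Rank1Residual.X9NoEntry
import HarnessLib

/-!
# BSD rank-≤1 residual cell: at a MULTIPLICATIVE prime `p ≥ 7`, an irreducible non-surjective
# `ρ̄_{E,p}` has image in the normaliser of a SPLIT Cartan subgroup (Serre 1972, §1.12 + §2)

HONEST FRAMING (cell `b2b-bsdres-*`, run/shared/lean/b2b/bsd-rank1-residual/, verbatim): the goal
of the cell is to DELETE the COMBINATION-SHAPED residual classes for ALL analytic-rank `≤ 1` elliptic
curves over `ℚ` — "full BSD formula for every rank `≤ 1` curve in class C" assembled STRICTLY from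
published theorems — so that the rank-`≤ 1` remainder becomes exactly the CONSTRUCTION-SHAPED
classes, which are TYPED (missing-input Props), NOT attempted; this is not "finishing BSD".
Prove what is provable now; shrink each hard class to its core with data; no claim beyond stated
classes. Unit `b2b-bsdres-x11c` (gen 7). Theorems only (no definition, no named fact); a TOOL file
about the Galois image at a multiplicative prime — nothing here is a class theorem, no label moves.

## What this file does

The unit's RESISTANT family for the `p`-adic certificate route at a multiplicative prime `p ≥ 5`
is `irr(p) ∧ ¬surj(p) ∧ ¬ram(p)` — "no divisibility source" (neither Kato–Wuthrich, which needs
`ρ̄_{E,p}` onto, nor Skinner 2016 Thm. A, which needs (ram)): the multiplicative analogue of class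
X9.  In Cremona's table (`N < 5·10⁵`) all `64` such rank-one pairs have `p = 5` (images `5S4`,
`5Ns`).  This file explains the `p = 5` concentration STRUCTURALLY, from tree theorems only:

* `exists_inertia_line_of_mult` — **Serre 1972 §1.12 (Tate curve), frame-free**: at a prime `𝔏`
  of `ℚ̄` over a multiplicative `p ≠ 2` there is `v₀ ∈ E[p] ∖ 0` with `I_𝔏` acting trivially on
  `E[p]/𝔽_p v₀` and through ALL of `𝔽_pˣ` on `𝔽_p v₀` (`ρ̄|I_𝔏 ≃ (χ *; 0 1)`, `χ = χ̄_p` onto);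
  the multiplicative branch of the tree's `inertia_shape_of_isSemistable`, with semistability
  replaced by the single local hypothesis `Mult W p`.
* `exists_halfSplitCartan_eq_inertia_image_of_mult` — in a frame `Φ : Aut(E[p]) ≃ GL₂(𝔽_p)`, if
  `p ∤ #G` (`G = Φ(ρ̄(Γ_ℚ))`) the image of `I_𝔏` IS a split half-Cartan subgroup
  `P (1 0; 0 *) P⁻¹` (Serre §2.1 a)).
* `exists_le_normalizer_cartan_of_mult_of_irr_of_not_surj` — **`p ≠ 2, 5`, `Mult ∧ Irr ∧ ¬Surj`
  ⟹ `G` normalises a Cartan subgroup `C` without being inside it**, and `G` contains a split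
  half-Cartan subgroup (Serre Prop. 15: `p ∤ #G`; Prop. 17, half-Cartan form
  `prop17_cases_halfSplitCartan`; the Borel case is excluded by `Irr`, the case `G ≤ C` by complex
  conjugation `exists_le_eigenvectorStabilizer_of_le_cartan`).
* `exists_le_normalizer_splitCartan_of_mult_of_irr_of_not_surj` — **for `p ≥ 7` the Cartan
  subgroup is SPLIT**, `C = P (* 0; 0 *) P⁻¹` with `P (1 0; 0 *) P⁻¹ ≤ G` (Prop. 14:
  `eq_splitCartan_of_halfSplitCartan_le_normalizer`, `p ≥ 5`); equivalently every `Φ(ρ̄ σ)`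
  is, after conjugation by `P`, DIAGONAL or ANTIDIAGONAL (`forall_isDg_or_isAd_of_mult_of_irr_of_not_surj`).
  So a multiplicative `p ≥ 7` with irreducible non-surjective `ρ̄_{E,p}` makes `E` a non-CM
  (`Mult ⇒ ¬CM`, *ATAEC* II.6.4), non-cuspidal rational point of `X_split(p) = X₀⁺(p²)`; by
  Bilu–Parent–Rebolledo 2013 Cor. 1.2 (`p ≥ 11`, `p ≠ 13`) and Balakrishnan–Dogra–Müller–Tuitman–Vonk
  2019 Thm. 1.2 (`p = 13`; "if and only if `ℓ ≤ 7`") there is none for `p ≥ 11` — that consequence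
  (one named fact) is drawn in the sequel file `MultiplicativeLargeImage.lean`, not here.
* `not_le_normalizer_unitGroup_of_mult_of_irr_of_not_surj` — in particular (`p ≥ 7`) the image is
  NOT in the normaliser of a non-split Cartan subgroup (a Cartan subgroup normalised by a split
  half-Cartan subgroup is split, Prop. 14).

What is NOT claimed: nothing at `p = 5` beyond the Cartan-normaliser-or-exceptional dichotomy of
Prop. 17 (there `5S4` and the split-Cartan normaliser `5Ns` both occur at multiplicative `5`:
`3240a1`, `52345a1`); nothing at `p = 3`; no class theorem; no surjectivity statement (sequel).

Data check (this gen, `work/scan/galrep_mult_scan.py` over Cremona's `galrep` tables, all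
`1 573 101` curves of conductor `< 5·10⁵` with a non-surjective prime): at primes `p ≥ 5` with
`p ∥ N` the non-surjective image codes are `5B` ×2948, `5Ns` ×28, `5S4` ×102, `7B` ×264 and
NOTHING at `p ≥ 11` — consistent with the theorems (Sutherland's `Ns` = normaliser of the SPLIT
Cartan; the unit's REPORT §4 gloss "5Ns (normaliser of non-split Cartan)" was a misreading of the
label and is corrected in REPORT §17).

## References

* [SerreInventiones1972] J.-P. Serre, Invent. Math. 15 (1972): §1.12 (Cor. of Prop. 13),
  §2.1 a), §2.2 Prop. 14, §2.4 Prop. 15, §2.7 Prop. 17, §5.4 proof of Prop. 21.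
* [BiluParentRebolledo2013] Yu. Bilu, P. Parent, M. Rebolledo, Ann. Inst. Fourier 63 (2013), Cor. 1.2.
* [BalakrishnanEtAl2019] J. S. Balakrishnan, N. Dogra, J. S. Müller, J. Tuitman, J. Vonk,
  Ann. of Math. 189 (2019), Thm. 1.2.
-/

noncomputable section

open scoped Classical NumberField
open IsDedekindDomain Field Matrix NumberField
open WeierstrassCurve Literature.NumberTheory.EllipticCurves Literature.NumberTheory.GaloisRepresentations
  Literature.NumberTheory.GaloisRepresentations.Serre1972 Rat.HeightOneSpectrum
  Literature.NumberTheory.EllipticCurves.Rank1Residual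

namespace Summit.BirchSwinnertonDyer.Rank1Residual.GaloisImage

variable (W : WeierstrassCurve ℚ) [W.IsElliptic] (p : ℕ) [hp : Fact p.Prime]

/-! ### §1.12 at a multiplicative prime: the inertia line, frame-free -/

/-- **Serre 1972 §1.12 (Cor. of Prop. 13) at a multiplicative `p ≠ 2`, frame-free.**  If `E = W/ℚ`
has multiplicative reduction at `p` (`Mult W p`), then for every prime `𝔏` of `ℚ̄` above `p` there
is `v₀ ∈ E[p] ∖ 0` such that the inertia group `I_𝔏` acts trivially on `E[p]/𝔽_p v₀` and acts on
the line `𝔽_p v₀` through EVERY element of `𝔽_pˣ` (the character on the line is `χ̄_p = det`,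
onto on inertia).  Proof = the multiplicative branch of the tree's
`WeierstrassCurve.inertia_shape_of_isSemistable` (Tate model: the subgroup `X`, `#X ≤ p`, of
`exists_addSubgroup_card_le_of_hasMultiplicativeReductionAt`; the character by
`exists_mem_inertia_smul_eq_of_sub_mem_line`), with `IsSemistable` replaced by `Mult W p` via
`hasMultiplicativeReductionAtPrime_iff_hasMultiplicativeReductionAt_ringOfIntegers`.
[cite: SerreInventiones1972, §1.12, Cor. of Prop. 13] -/
theorem exists_inertia_line_of_mult (hp2 : p ≠ 2) (hmult : Mult W p)
    {v : HeightOneSpectrum (𝓞 ℚ)} (hv : (primesEquiv v : ℕ) = p)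
    {𝔏 : Ideal (absIntegers (𝓞 ℚ) ℚ)} (h𝔏 : 𝔏 ∈ v.primesAbove) :
    letI : Module (ZMod p) (geomTorsion W p) := AddSubgroup.torsionBy.zmodModule
    ∃ v₀ : geomTorsion W p, v₀ ≠ 0 ∧
      (∀ τ ∈ 𝔏.inertia (absoluteGaloisGroup ℚ), ∀ x : geomTorsion W p,
        ∃ b : ZMod p, τ • x - x = b • v₀) ∧
      (∀ a : (ZMod p)ˣ, ∃ τ ∈ 𝔏.inertia (absoluteGaloisGroup ℚ),
        τ • v₀ = (a : ZMod p) • v₀) := by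
  letI : Module (ZMod p) (geomTorsion W p) := AddSubgroup.torsionBy.zmodModule
  have hpp : p.Prime := hp.out
  haveI : NeZero p := ⟨hpp.ne_zero⟩
  have hsurj_of : ∀ v₀ : geomTorsion W p, v₀ ≠ 0 →
      (∀ τ ∈ 𝔏.inertia (absoluteGaloisGroup ℚ), ∀ x : geomTorsion W p,
        ∃ b : ZMod p, τ • x - x = b • v₀) →
      ∀ a : (ZMod p)ˣ, ∃ τ ∈ 𝔏.inertia (absoluteGaloisGroup ℚ), τ • v₀ = (a : ZMod p) • v₀ :=
    fun v₀ hv₀ hquot a ↦ W.exists_mem_inertia_smul_eq_of_sub_mem_line p hv h𝔏 hv₀ hquot a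
  -- `p ∈ v`
  have hvp : (p : 𝓞 ℚ) ∈ v.asIdeal := by
    have hgen : natGenerator v = p := hv
    have h := (natGenerator_dvd_iff v).mp dvd_rfl
    rw [← map_natCast (Rat.IsIntegralClosure.intEquiv (𝓞 ℚ)), Ideal.apply_mem_of_equiv_iff] at h
    rwa [hgen] at h
  -- multiplicative reduction at the place `v`
  have hmult' : haveI := Fact.mk (primesEquiv v).2
      W.HasMultiplicativeReductionAtPrime (primesEquiv v) := by
    have key : ∀ (q : ℕ) (hq : Fact q.Prime), q = p →
        @WeierstrassCurve.HasMultiplicativeReductionAtPrime W q hq := by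
      rintro q hq rfl; exact hmult
    exact key _ _ hv
  have hmultv : W.HasMultiplicativeReductionAt v :=
    (W.hasMultiplicativeReductionAtPrime_iff_hasMultiplicativeReductionAt_ringOfIntegers v).mp hmult'
  -- the subgroup `X`, `#X ≤ p`, of the Tate model
  obtain ⟨X, hXcard, hX⟩ :=
    W.exists_addSubgroup_card_le_of_hasMultiplicativeReductionAt hp2 hvp hmultv h𝔏
  have hcard : Nat.card (geomTorsion W p) = p ^ 2 :=
    card_torsionPoints_eq_sq_holds W (AlgebraicClosure ℚ) (n := p)
      (Nat.cast_ne_zero.mpr hpp.ne_zero)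
  haveI : Finite (geomTorsion W p) :=
    Nat.finite_of_card_ne_zero (by rw [hcard]; exact pow_ne_zero _ hpp.ne_zero)
  by_cases hXbot : X = ⊥
  · haveI : Nontrivial (geomTorsion W p) := Finite.one_lt_card_iff_nontrivial.mp (by
      rw [hcard]; nlinarith [hpp.two_le])
    obtain ⟨v₀, hv₀⟩ := exists_ne (0 : geomTorsion W p)
    have hquot : ∀ τ ∈ 𝔏.inertia (absoluteGaloisGroup ℚ), ∀ x : geomTorsion W p,
        ∃ b : ZMod p, τ • x - x = b • v₀ := fun τ hτ x ↦ ⟨0, by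
      have h := hX τ hτ x
      rw [hXbot, AddSubgroup.mem_bot] at h
      rw [h, zero_smul]⟩
    exact ⟨v₀, hv₀, hquot, hsurj_of v₀ hv₀ hquot⟩
  · have hXtop : X ≠ ⊤ := by
      intro h
      rw [h, AddSubgroup.card_top, hcard] at hXcard
      nlinarith [hpp.two_le]
    obtain ⟨v₀, -, hv₀, hXeq⟩ := exists_eq_zmultiples_of_ne_bot_of_ne_top W p X hXbot hXtop
    have hquot : ∀ τ ∈ 𝔏.inertia (absoluteGaloisGroup ℚ), ∀ x : geomTorsion W p,
        ∃ b : ZMod p, τ • x - x = b • v₀ := fun τ hτ x ↦ by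
      have h := hX τ hτ x
      rw [hXeq] at h
      obtain ⟨m, hm⟩ := AddSubgroup.mem_zmultiples_iff.mp h
      exact ⟨(m : ZMod p), by rw [Int.cast_smul_eq_zsmul, hm]⟩
    exact ⟨v₀, hv₀, hquot, hsurj_of v₀ hv₀ hquot⟩

/-! ### In a frame: the inertia image is a split half-Cartan subgroup -/

section Frame

variable (Φ : Multiplicative (AddAut (geomTorsion W p)) ≃* GL (Fin 2) (ZMod p))
  (e : geomTorsion W p ≃+ (Fin 2 → ZMod p))
  (he : ∀ (g : Multiplicative (AddAut (geomTorsion W p))) (x : geomTorsion W p),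
    e (Multiplicative.toAdd g x) =
      ((Φ g : GL (Fin 2) (ZMod p)) : Matrix (Fin 2) (Fin 2) (ZMod p)) *ᵥ e x)

include he in
/-- **The image of inertia at a multiplicative `p ≠ 2` is a split half-Cartan subgroup** once
`p ∤ #G` (`G = Φ(ρ̄_{E,p}(Γ_ℚ))`): `Φ(ρ̄(I_𝔏)) = P (1 0; 0 *) P⁻¹` for some `P ∈ GL₂(𝔽_p)` (Serre
§2.1 a): the line of `exists_inertia_line_of_mult` with full character and no unipotent part,
`eq_halfSplitCartan_map_of_not_dvd_card`). [cite: SerreInventiones1972, §1.12 and §2.1 a)] -/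
theorem exists_halfSplitCartan_eq_inertia_image_of_mult (hp2 : p ≠ 2) (hmult : Mult W p)
    (hG : ¬ p ∣ Nat.card ((galoisRepTorsion W p).range.map Φ.toMonoidHom))
    {v : HeightOneSpectrum (𝓞 ℚ)} (hv : (primesEquiv v : ℕ) = p)
    {𝔏 : Ideal (absIntegers (𝓞 ℚ) ℚ)} (h𝔏 : 𝔏 ∈ v.primesAbove) :
    ∃ P : GL (Fin 2) (ZMod p),
      ((𝔏.inertia (absoluteGaloisGroup ℚ)).map (galoisRepTorsion W p)).map Φ.toMonoidHom =
        halfSplitCartan P := by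
  letI : Module (ZMod p) (geomTorsion W p) := AddSubgroup.torsionBy.zmodModule
  set ρ := galoisRepTorsion W p with hρ
  have hHle : ((𝔏.inertia (absoluteGaloisGroup ℚ)).map ρ).map Φ.toMonoidHom ≤
      ρ.range.map Φ.toMonoidHom := Subgroup.map_mono (fun x ⟨τ, _, hτ⟩ ↦ ⟨τ, hτ⟩)
  have hpH : ¬ p ∣ Nat.card (((𝔏.inertia (absoluteGaloisGroup ℚ)).map ρ).map Φ.toMonoidHom) :=
    fun h ↦ hG (h.trans (Subgroup.card_dvd_of_le hHle))
  obtain ⟨v₀, hv₀, hquot, hsurj⟩ := exists_inertia_line_of_mult W p hp2 hmult hv h𝔏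
  obtain ⟨P, -, hP⟩ := eq_halfSplitCartan_map_of_not_dvd_card e Φ he
    (I := (𝔏.inertia (absoluteGaloisGroup ℚ)).map ρ) hv₀
    (fun τ' ⟨τ, hτ, hτ'⟩ x ↦ by subst hτ'; exact hquot τ hτ x)
    (fun a ↦ by
      obtain ⟨τ, hτ, hτv⟩ := hsurj a
      exact ⟨ρ τ, ⟨τ, hτ, rfl⟩, hτv⟩) hpH
  exact ⟨P, hP⟩

include he in
/-- **`Mult ∧ Irr ∧ ¬Surj` at `p ≠ 2, 5` ⟹ `G` normalises a Cartan subgroup without lying in it,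
and contains a split half-Cartan subgroup.**  `p ∤ #G` by Prop. 15 (`Irr`, `¬Surj`, `det` onto:
`not_dvd_card_of_not_hasSurjectiveModNGaloisRep`); the inertia at `p` is then a split half-Cartan
subgroup `P (1 0; 0 *) P⁻¹ ≤ G` (`exists_halfSplitCartan_eq_inertia_image_of_mult`); Prop. 17
(`prop17_cases_halfSplitCartan`, `p ≠ 5`) leaves `G = GL₂` (excluded: `¬Surj`), Borel (excluded:
`Irr`), `G ≤ C` (excluded: complex conjugation, `exists_le_eigenvectorStabilizer_of_le_cartan`,
gives a Borel), or `G ≤ N(C)`, `G ⊄ C`. [cite: SerreInventiones1972, §2.4 Prop. 15, §2.7 Prop. 17,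
§5.4 proof of Prop. 21] -/
theorem exists_le_normalizer_cartan_of_mult_of_irr_of_not_surj (hp2 : p ≠ 2) (hp5 : p ≠ 5)
    (hmult : Mult W p) (hirr : Irr W p) (hns : ¬ Surj W p) :
    ∃ P : GL (Fin 2) (ZMod p),
      halfSplitCartan P ≤ (galoisRepTorsion W p).range.map Φ.toMonoidHom ∧
      ∃ C ∈ cartanSubgroups (ZMod p),
        (galoisRepTorsion W p).range.map Φ.toMonoidHom ≤
            Subgroup.normalizer (C : Set (GL (Fin 2) (ZMod p))) ∧
          ¬ (galoisRepTorsion W p).range.map Φ.toMonoidHom ≤ C := by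
  have hpp : p.Prime := hp.out
  set ρ := galoisRepTorsion W p with hρ
  set G : Subgroup (GL (Fin 2) (ZMod p)) := ρ.range.map Φ.toMonoidHom with hGdef
  have hGtop : G ≠ ⊤ := fun h ↦ hns ((map_range_galoisRepTorsion_eq_top_iff W p Φ).mp h)
  have hpG : ¬ p ∣ Nat.card G :=
    not_dvd_card_of_not_hasSurjectiveModNGaloisRep W p Φ e he hirr hns
  -- the place `v = (p)` and a prime of `ℚ̄` above it
  set v : HeightOneSpectrum (𝓞 ℚ) := (primesEquiv (R := 𝓞 ℚ)).symm ⟨p, hpp⟩ with hvdef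
  have hv' : primesEquiv v = ⟨p, hpp⟩ := Equiv.apply_symm_apply _ _
  have hv : (primesEquiv v : ℕ) = p := congrArg Subtype.val hv'
  obtain ⟨𝔏, h𝔏⟩ := HeightOneSpectrum.primesAbove_nonempty v
  obtain ⟨P, hP⟩ :=
    exists_halfSplitCartan_eq_inertia_image_of_mult W p Φ e he hp2 hmult hpG hv h𝔏
  have hCG : halfSplitCartan P ≤ G := by
    rw [← hP]
    exact Subgroup.map_mono (fun x ⟨τ, _, hτ⟩ ↦ ⟨τ, hτ⟩)
  refine ⟨P, hCG, ?_⟩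
  obtain ⟨c, hcG, hc, hdet⟩ := exists_conj_mem_map_range W p Φ e he
  rcases prop17_cases_halfSplitCartan G hp5 P hCG with htop | ⟨w, hw, hB⟩ | ⟨C, hC, hGC⟩ | h
  · exact absurd htop hGtop
  · exact absurd hB (not_le_eigenvectorStabilizer_of_hasIrreducibleModPGaloisRep W p Φ e he hirr hw)
  · obtain ⟨w, hw, hB⟩ := exists_le_eigenvectorStabilizer_of_le_cartan hp2 hC hGC hcG hc hdet
    exact absurd hB (not_le_eigenvectorStabilizer_of_hasIrreducibleModPGaloisRep W p Φ e he hirr hw)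
  · exact h

include he in
/-- **At a multiplicative `p ≥ 7`, `Irr ∧ ¬Surj` ⟹ the image lies in the normaliser of a SPLIT
Cartan subgroup `P (* 0; 0 *) P⁻¹`, not in the Cartan subgroup itself, and contains the split
half-Cartan subgroup `P (1 0; 0 *) P⁻¹`.**  The Cartan subgroup of
`exists_le_normalizer_cartan_of_mult_of_irr_of_not_surj` is normalised by the inertia half-Cartan
subgroup, hence split and equal to `P (* 0; 0 *) P⁻¹` by Prop. 14
(`eq_splitCartan_of_halfSplitCartan_le_normalizer`, `p ≥ 5`).  In words: `E` defines a non-CM,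
non-cuspidal `ℚ`-point of `X_split(p) ≃ X₀⁺(p²)`.
[cite: SerreInventiones1972, §2.2 Prop. 14, §2.7 Prop. 17] -/
theorem exists_le_normalizer_splitCartan_of_mult_of_irr_of_not_surj (h7 : 7 ≤ p)
    (hmult : Mult W p) (hirr : Irr W p) (hns : ¬ Surj W p) :
    ∃ P : GL (Fin 2) (ZMod p),
      halfSplitCartan P ≤ (galoisRepTorsion W p).range.map Φ.toMonoidHom ∧
      (galoisRepTorsion W p).range.map Φ.toMonoidHom ≤
          Subgroup.normalizer (splitCartan P : Set (GL (Fin 2) (ZMod p))) ∧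
        ¬ (galoisRepTorsion W p).range.map Φ.toMonoidHom ≤ splitCartan P := by
  have hp2 : p ≠ 2 := by omega
  have hp5 : p ≠ 5 := by omega
  have h5 : 5 ≤ p := by omega
  obtain ⟨P, hCG, C, hC, hGN, hGC⟩ :=
    exists_le_normalizer_cartan_of_mult_of_irr_of_not_surj W p Φ e he hp2 hp5 hmult hirr hns
  have hCeq : C = splitCartan P :=
    eq_splitCartan_of_halfSplitCartan_le_normalizer hC h5 (hCG.trans hGN)
  subst hCeq
  exact ⟨P, hCG, hGN, hGC⟩

include he in
/-- **Matrix form**: at a multiplicative `p ≥ 7` with `Irr ∧ ¬Surj` there is `P ∈ GL₂(𝔽_p)` such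
that for EVERY `σ ∈ Γ_ℚ` the matrix `P⁻¹ Φ(ρ̄ σ) P` is diagonal or antidiagonal, and for some `σ`
it is antidiagonal and not diagonal (the image meets `N ∖ C`). (`mem_normalizer_splitCartan_iff`.)
[cite: SerreInventiones1972, §2.2] -/
theorem forall_isDg_or_isAd_of_mult_of_irr_of_not_surj (h7 : 7 ≤ p)
    (hmult : Mult W p) (hirr : Irr W p) (hns : ¬ Surj W p) :
    ∃ P : GL (Fin 2) (ZMod p),
      (∀ σ : absoluteGaloisGroup ℚ,
        GL2.IsDg ((P⁻¹ * Φ (galoisRepTorsion W p σ) * P : GL (Fin 2) (ZMod p)) :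
            Matrix (Fin 2) (Fin 2) (ZMod p)) ∨
          GL2.IsAd ((P⁻¹ * Φ (galoisRepTorsion W p σ) * P : GL (Fin 2) (ZMod p)) :
            Matrix (Fin 2) (Fin 2) (ZMod p))) ∧
      ∃ σ : absoluteGaloisGroup ℚ,
        ¬ GL2.IsDg ((P⁻¹ * Φ (galoisRepTorsion W p σ) * P : GL (Fin 2) (ZMod p)) :
            Matrix (Fin 2) (Fin 2) (ZMod p)) := by
  have hp2 : p ≠ 2 := by omega
  have hF : ∃ u : (ZMod p)ˣ, u ≠ 1 := exists_units_ne_one hp2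
  obtain ⟨P, -, hGN, hGC⟩ :=
    exists_le_normalizer_splitCartan_of_mult_of_irr_of_not_surj W p Φ e he h7 hmult hirr hns
  refine ⟨P, fun σ ↦ ?_, ?_⟩
  · exact (mem_normalizer_splitCartan_iff hF).mp (hGN (apply_galoisRepTorsion_mem_map_range W p Φ σ))
  · by_contra hall
    apply hGC
    intro g hg
    obtain ⟨σ, rfl⟩ := (mem_map_range_galoisRepTorsion_iff W p Φ).mp hg
    exact mem_splitCartan_iff.mpr (by by_contra h; exact hall ⟨σ, h⟩)

include he in
/-- **Not a non-split Cartan normaliser** (`p ≥ 7`, `Mult ∧ Irr ∧ ¬Surj`): for every subfield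
`k ⊆ M₂(𝔽_p)` of degree `2`, `G ⊄ N(kˣ)`.  (A Cartan subgroup normalised by the inertia split
half-Cartan subgroup is split, Prop. 14; a split and a non-split Cartan subgroup sharing that
non-scalar subgroup would coincide, `eq_of_mem_of_mem_cartanSubgroups`, but `kˣ` contains no
non-scalar element with an eigenvalue `1` — `forall_ne_zero_of_isField`.)
[cite: SerreInventiones1972, §2.2 Prop. 14] -/
theorem not_le_normalizer_unitGroup_of_mult_of_irr_of_not_surj (h7 : 7 ≤ p)
    (hmult : Mult W p) (hirr : Irr W p) (hns : ¬ Surj W p)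
    {k : Subalgebra (ZMod p) (Matrix (Fin 2) (Fin 2) (ZMod p))} (hk : IsField k)
    (h2 : Module.finrank (ZMod p) k = 2) :
    ¬ (galoisRepTorsion W p).range.map Φ.toMonoidHom ≤
        Subgroup.normalizer (unitGroup k : Set (GL (Fin 2) (ZMod p))) := by
  intro hGN
  have hp2 : p ≠ 2 := by omega
  have hp5 : p ≠ 5 := by omega
  have h5 : 5 ≤ p := by omega
  obtain ⟨P, hCG, -⟩ :=
    exists_le_normalizer_cartan_of_mult_of_irr_of_not_surj W p Φ e he hp2 hp5 hmult hirr hns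
  have hkC : unitGroup k ∈ cartanSubgroups (ZMod p) := unitGroup_mem_cartanSubgroups hk h2
  have hCeq : unitGroup k = splitCartan P :=
    eq_splitCartan_of_halfSplitCartan_le_normalizer hkC h5 (hCG.trans hGN)
  -- the element `P diag(1,u) P⁻¹`, `u ≠ 1`, of the half-Cartan subgroup lies in `kˣ`: absurd
  obtain ⟨u, hu⟩ := exists_units_ne_one hp2
  have hmem : (MulAut.conj P).toMonoidHom (halfDiagonalHom u) ∈ unitGroup k := by
    rw [hCeq]
    exact halfSplitCartan_le_splitCartan P
      ⟨halfDiagonalHom u, by rw [← range_halfDiagonalHom]; exact ⟨u, rfl⟩, rfl⟩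
  have hy : (((MulAut.conj P).toMonoidHom (halfDiagonalHom u) : GL (Fin 2) (ZMod p)) :
      Matrix (Fin 2) (Fin 2) (ZMod p)) ∈ k := mem_unitGroup_iff.mp hmem
  have hys := conj_halfDiagonalHom_ne_smul_one P hu
  have hno := forall_ne_zero_of_isField hk hy hys
  -- `1` is a root of the characteristic polynomial of `P diag(1,u) P⁻¹`
  apply hno 1
  have htr : Matrix.trace ((((MulAut.conj P).toMonoidHom (halfDiagonalHom u) : GL (Fin 2) (ZMod p)) :
      Matrix (Fin 2) (Fin 2) (ZMod p))) = 1 + (u : ZMod p) := by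
    rw [MulEquiv.coe_toMonoidHom, MulAut.conj_apply, Units.val_mul, Units.val_mul,
      Matrix.trace_mul_cycle, Matrix.coe_units_inv, Matrix.nonsing_inv_mul _ (GL2.det_ne_zero P).isUnit,
      Matrix.one_mul, coe_halfDiagonalHom]
    simp [Matrix.trace, Fin.sum_univ_two]
  have hdet : Matrix.det ((((MulAut.conj P).toMonoidHom (halfDiagonalHom u) : GL (Fin 2) (ZMod p)) :
      Matrix (Fin 2) (Fin 2) (ZMod p))) = (u : ZMod p) := by
    have h := det_halfDiagonalHom u
    have hPP : Matrix.det (P : Matrix (Fin 2) (Fin 2) (ZMod p)) *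
        Matrix.det ((P : Matrix (Fin 2) (Fin 2) (ZMod p))⁻¹) = 1 := by
      rw [← Matrix.det_mul, Matrix.mul_nonsing_inv _ (GL2.det_ne_zero P).isUnit, Matrix.det_one]
    rw [MulEquiv.coe_toMonoidHom, MulAut.conj_apply, Units.val_mul, Units.val_mul, Matrix.det_mul,
      Matrix.det_mul, Matrix.coe_units_inv, mul_comm (Matrix.det (P : Matrix (Fin 2) (Fin 2) (ZMod p))),
      mul_assoc, hPP, mul_one]
    have := congrArg (fun x : (ZMod p)ˣ ↦ (x : ZMod p)) h
    simpa [Matrix.GeneralLinearGroup.val_det_apply] using this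
  rw [htr, hdet]
  ring

end Frame

/-! ### Frame-free summary -/

/-- **Frame-free summary.**  Let `E = W/ℚ` have multiplicative reduction at a prime `p ≥ 7` with
`E[p]` irreducible and `ρ̄_{E,p}` not surjective.  Then for every `𝔽_p`-frame
`(e, Φ)` of `E[p]` there is `P ∈ GL₂(𝔽_p)` with every `P⁻¹ Φ(ρ̄ σ) P` diagonal or antidiagonal:
the image of `ρ̄_{E,p}` is contained in the normaliser of a split Cartan subgroup of `GL₂(𝔽_p)`
(and frames exist: `exists_frame_galoisRepTorsion_rat`).  This is the hypothesis of
Bilu–Parent–Rebolledo 2013 Cor. 1.2 / BDMTV 2019 Thm. 1.2, consumed in the sequel.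
[cite: SerreInventiones1972, §1.12, §2.2, §2.7] -/
theorem exists_frame_isDg_or_isAd_of_mult_of_irr_of_not_surj (h7 : 7 ≤ p)
    (hmult : Mult W p) (hirr : Irr W p) (hns : ¬ Surj W p) :
    ∃ (e : geomTorsion W p ≃+ (Fin 2 → ZMod p))
      (Φ : Multiplicative (AddAut (geomTorsion W p)) ≃* GL (Fin 2) (ZMod p)),
      (∀ (g : Multiplicative (AddAut (geomTorsion W p))) (x : geomTorsion W p),
        e (Multiplicative.toAdd g x) =
          ((Φ g : GL (Fin 2) (ZMod p)) : Matrix (Fin 2) (Fin 2) (ZMod p)) *ᵥ e x) ∧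
      ∃ P : GL (Fin 2) (ZMod p), ∀ σ : absoluteGaloisGroup ℚ,
        GL2.IsDg ((P⁻¹ * Φ (galoisRepTorsion W p σ) * P : GL (Fin 2) (ZMod p)) :
            Matrix (Fin 2) (Fin 2) (ZMod p)) ∨
          GL2.IsAd ((P⁻¹ * Φ (galoisRepTorsion W p σ) * P : GL (Fin 2) (ZMod p)) :
            Matrix (Fin 2) (Fin 2) (ZMod p)) := by
  obtain ⟨e, Φ, he, -⟩ := exists_frame_galoisRepTorsion_rat W p
  obtain ⟨P, hP, -⟩ := forall_isDg_or_isAd_of_mult_of_irr_of_not_surj W p Φ e he h7 hmult hirr hns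
  exact ⟨e, Φ, he, P, hP⟩

end Summit.BirchSwinnertonDyer.Rank1Residual.GaloisImage
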